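import Summits.QuantumFields.BalabanUV.Beta.FP.TorusCompositeIndexWardTwo

/-!
# `BalabanUV.Beta.FP.TorusCompositeCovarianceTwoPolar` — road «FP» for binder row D1, ROUTE T, (COV-m) ORDER 2 AT EVERY DEPTH, POLARISED:
# **THE SYMMETRIC BILINEAR COMPANIONS `stepIns₂₂ w w′` ∕ `compIns₂₂ … n h h′` OF OUR ONE-STEP AND COMPOSITE SECOND JETS** — diagonal = I-3 `stepIns₂` ∕ I-4 `compIns₂`
# (`rfl` ∕ induction), SYMMETRIC (PART 1's pair swap), BILINEAR (induction), and the polarisation identity `compIns₂ (h + h′) = compIns₂ h + (compIns₂₂ h h′ + compIns₂₂ h h′) + compIns₂ h′`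

WHY.  The OWNER d1-p3's door-to-kernel bridge (#33 `DirectionalDoorKernelLaw.mixedVar_kernel_law_of_directional_door`, #36b ∕ #37 at level 0) reads a door stated for EVERY
direction `v` with its second jets given as DIAGONALS OF BILINEAR MAPS of `v`; at level 0 the one-step bi-tables `Q₁₂ w w′ := ΣΣ (w b·w′ b′) • T^{b,b′}` are visibly bilinear
(#36a `bilin_sum_sum_*`).  For the composite door #21 ∕ #21♭ (the `j ≥ 2` assembly #41) the fine second jet is OUR `compIns₂ … n h` (I-4), a quadratic function of ONE
weight; this file supplies its MIXED companion `compIns₂₂ … n h h′` (the ♭ recursion polarised: `(θ∕σ)•stepIns₂₂(Ch, Ch′)·C + θ•(stepIns₁(Ch)·compIns₁ h′ + stepIns₁(Ch′)·compIns₁ h)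
+ Qstep·compIns₂₂^{low} h h′`) with the four facts a polarisation needs — diagonal, symmetry, additivity and homogeneity in each slot — and the expansion of `compIns₂` at a sum.

WHAT.  §1 [our object — bookkeeping] `stepIns₂₂` + `stepIns₂₂_self` (`rfl`), `stepIns₂₂_add_left ∕ _smul_left ∕ _add_right ∕ _smul_right`, `stepIns₂₂_comm` (PART 1
`submatrix_perF_dper_borderT2_swap` at C1's slot maps); §2 [our object — bookkeeping] `compIns₂₂` + `compIns₂₂_zero ∕ _succ` (`rfl`), `compIns₂₂_self`, `compIns₂₂_comm`,
`compIns₂₂_add_left`, `compIns₂₂_smul_left` (inductions in the push-inside types, g22's pattern), `compIns₂₂_add_right ∕ _smul_right` (by symmetry), **`compIns₂_add`**.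
Two bookkeeping defs + [folklore] finite sums BY NAME; no `def … : Prop`, nothing cited, 0 sorry.  Nothing of the dictionary ∕ Bałaban's asserted (♭ CANDIDATE, R-FP-63 (v)).

HONEST DEPENDENCY (page 1, mandatory): continuum YM on T⁴ ⇐ BetaPertH ∧ nine spine estimates (0/9 proved); BetaPertH ⇐ (D1) ∧ (D4) ∧ CAP+tail;
G-an2-4 gates asym, D1 and NE2/3/4.  HONEST FRAMING (cell contract, verbatim): «discharging `BetaPertH` makes Bałaban's UV stability UNCONDITIONAL —
a real constructive-QFT result; it is NOT the continuum limit and NOT the Clay problem.»  ABSOLUTE RULE (cell charter, verbatim): «No internally-minted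
statement may enter as a cited fact. Every hypothesis is either kernel-proved in this package or a verbatim quotation of a PUBLISHED theorem with page
reference. The manuscript(s) under audit are NOT citable for their own disputed steps — they are the thing under adjudication; programme-internal
(2001/route/tribunal) claims are never citable.»  0 estimates; 0∕4 row-D1 binders (hW, hR, D1Tel, D1Rep); NOT (T-ID), NOT (J-a) complete, NOT SDF, NOT D1,
NOT BetaPertH, NOT continuum, NOT Clay.  D1 formalisation swarm LEAF PROVER 02 (b2b-balaban-beta-d1-formalise-leaf-02 gen 26), 2026-08-23.  No existing file touched.
-/

noncomputable section

open scoped BigOperators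

namespace Summit.QuantumFields.BalabanUV.Beta.FP.TorusCompositeCovarianceTwoPolar

open Matrix Finset
open Literature.MathematicalPhysics.QuantumFieldTheory
open Literature.MathematicalPhysics.QuantumFieldTheory.Balaban1983to89
open Literature.MathematicalPhysics.QuantumFieldTheory.Balaban1983to89.Beta
open ExpKernelCalculus (MKer)
open B4TorusKernel.MultiPeriod (translate)
open B5Prop11Plancherel (fine)
open B6Lemma24Torus (pbox)
open AffineAveraging (Site box toSite)
open AveragingMixedJetTables (vh₂SAt)
open OneStepResolventKernel (Fib)
open Summit.QuantumFields.BalabanUV.Beta.BorderedHessian (stepScale)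
open Summit.QuantumFields.BalabanUV.Beta.FP.KernelPeriodisationFib (Idx perF)
open Summit.QuantumFields.BalabanUV.Beta.FP.KernelPeriodisationFibLoc (dper)
open Summit.QuantumFields.BalabanUV.Beta.FP.TorusGaugeCovarianceCoarse (coarsePt)
open Summit.QuantumFields.BalabanUV.Beta.FP.TorusCompositeObjects
open Summit.QuantumFields.BalabanUV.Beta.FP.TorusCompositeCovarianceOne (stepIns₁ compIns₁ compIns₁_zero)
open Summit.QuantumFields.BalabanUV.Beta.FP.TorusCompositeCovarianceTwoStep (stepIns₂)
open Summit.QuantumFields.BalabanUV.Beta.FP.TorusCompositeCovarianceTwo (compIns₂ compIns₂_zero)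
open Summit.QuantumFields.BalabanUV.Beta.FP.TorusCompositeIndexWardOne (stepIns₁_add stepIns₁_smul compIns₁_add compIns₁_smul)
open Summit.QuantumFields.BalabanUV.Beta.FP.PeriodisedBorderIndexWardTwo (submatrix_perF_dper_borderT2_swap)

variable {d : ℕ}

/-! ## §1 The one-step bilinear companion -/

section OneStep

variable (M : Fin (d + 1) → ℕ) [∀ μ, NeZero (M μ)] (Lc : ℕ) [NeZero Lc] {r : Fin (d + 1) → ℕ}

/-- [our object — bookkeeping] **THE ONE-STEP SECOND-ORDER INSERTION BI-JET ALONG TWO BOND WEIGHTS `w, w′`** (I-3 `stepIns₂`'s symmetrised rooted pair inserted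
along `w` in its first bond and `w′` in its second; C1's slot maps; level-free). -/
def stepIns₂₂ (r : Fin (d + 1) → ℕ) (w w' : ↥(pbox (fine Lc M)) × Fin (d + 1) → ℝ) :
    Matrix (↥(pbox M) × Fin (d + 1)) (↥(pbox (fine Lc M)) × Fin (d + 1)) ℝ :=
  ∑ b : ↥(pbox (fine Lc M)) × Fin (d + 1), ∑ b' : ↥(pbox (fine Lc M)) × Fin (d + 1), (w b * w' b') •
    (perF (fine Lc M) (dper (fine Lc M) (fun x z a c => ∑' n : Site (d + 1), (1 / 2 : ℝ) *
        (vh₂SAt (toSite r) Lc b.2 (b.1 : Site (d + 1)) b'.2 (translate (fine Lc M) (b'.1 : Site (d + 1)) n) x z a c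
          + vh₂SAt (toSite r) Lc b'.2 (translate (fine Lc M) (b'.1 : Site (d + 1)) n) b.2 (b.1 : Site (d + 1)) x z a c)))).submatrix
      (fun a : ↥(pbox M) × Fin (d + 1) => ((coarsePt M Lc a.1, Sum.inr a.2) : Idx (fine Lc M) (Fib d)))
      (fun c : ↥(pbox (fine Lc M)) × Fin (d + 1) => ((c.1, Sum.inl c.2) : Idx (fine Lc M) (Fib d)))

omit [∀ μ, NeZero (M μ)] in
/-- [folklore] the diagonal of the bi-jet IS I-3's second jet (`rfl`). -/
theorem stepIns₂₂_self (r : Fin (d + 1) → ℕ) (w : ↥(pbox (fine Lc M)) × Fin (d + 1) → ℝ) : stepIns₂₂ M Lc r w w = stepIns₂ M Lc r w := rfl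

omit [∀ μ, NeZero (M μ)] in
/-- [folklore] additive in the first weight. -/
theorem stepIns₂₂_add_left (r : Fin (d + 1) → ℕ) (w₁ w₂ w' : ↥(pbox (fine Lc M)) × Fin (d + 1) → ℝ) :
    stepIns₂₂ M Lc r (w₁ + w₂) w' = stepIns₂₂ M Lc r w₁ w' + stepIns₂₂ M Lc r w₂ w' := by
  simp only [stepIns₂₂, Pi.add_apply, add_mul, add_smul, Finset.sum_add_distrib]

omit [∀ μ, NeZero (M μ)] in
/-- [folklore] homogeneous in the first weight. -/
theorem stepIns₂₂_smul_left (r : Fin (d + 1) → ℕ) (a : ℝ) (w w' : ↥(pbox (fine Lc M)) × Fin (d + 1) → ℝ) :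
    stepIns₂₂ M Lc r (a • w) w' = a • stepIns₂₂ M Lc r w w' := by
  simp only [stepIns₂₂, Pi.smul_apply, smul_eq_mul, mul_assoc, mul_smul, Finset.smul_sum]

omit [∀ μ, NeZero (M μ)] in
/-- [folklore] additive in the second weight. -/
theorem stepIns₂₂_add_right (r : Fin (d + 1) → ℕ) (w w₁ w₂ : ↥(pbox (fine Lc M)) × Fin (d + 1) → ℝ) :
    stepIns₂₂ M Lc r w (w₁ + w₂) = stepIns₂₂ M Lc r w w₁ + stepIns₂₂ M Lc r w w₂ := by
  simp only [stepIns₂₂, Pi.add_apply, mul_add, add_smul, Finset.sum_add_distrib]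

omit [∀ μ, NeZero (M μ)] in
/-- [folklore] homogeneous in the second weight. -/
theorem stepIns₂₂_smul_right (r : Fin (d + 1) → ℕ) (a : ℝ) (w w' : ↥(pbox (fine Lc M)) × Fin (d + 1) → ℝ) :
    stepIns₂₂ M Lc r w (a • w') = a • stepIns₂₂ M Lc r w w' := by
  simp only [stepIns₂₂, Pi.smul_apply, smul_eq_mul, mul_left_comm _ a, mul_smul, Finset.smul_sum]

/-- [folklore] **SYMMETRIC** (`r ∈ box`): `stepIns₂₂ w w′ = stepIns₂₂ w′ w` — PART 1's pair swap `T^{b,b′} = T^{b′,b}` at C1's slot maps, then `Finset.sum_comm`. -/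
theorem stepIns₂₂_comm (hr : r ∈ box (d + 1) Lc) (w w' : ↥(pbox (fine Lc M)) × Fin (d + 1) → ℝ) :
    stepIns₂₂ M Lc r w w' = stepIns₂₂ M Lc r w' w := by
  obtain ⟨W, hW⟩ : ∃ W : Fin (d + 1) → Site (d + 1) → Fin (d + 1) → Site (d + 1) → MKer (d + 1) (Fib d),
      W = fun κ' u' κ u x z a c => ∑' n : Site (d + 1), (1 / 2 : ℝ) * (vh₂SAt (toSite r) Lc κ u κ' (translate (fine Lc M) u' n) x z a c
        + vh₂SAt (toSite r) Lc κ' (translate (fine Lc M) u' n) κ u x z a c) := ⟨_, rfl⟩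
  have hS : ∀ v v' : ↥(pbox (fine Lc M)) × Fin (d + 1) → ℝ, stepIns₂₂ M Lc r v v'
      = ∑ b : ↥(pbox (fine Lc M)) × Fin (d + 1), ∑ b' : ↥(pbox (fine Lc M)) × Fin (d + 1), (v b * v' b') •
          (perF (fine Lc M) (dper (fine Lc M) (W b'.2 (b'.1 : Site (d + 1)) b.2 (b.1 : Site (d + 1))))).submatrix
            (fun a : ↥(pbox M) × Fin (d + 1) => (((⟨(coarsePt M Lc a.1 : Site (d + 1)), (coarsePt M Lc a.1).2⟩ : ↥(pbox (fine Lc M))), Sum.inr a.2) : Idx (fine Lc M) (Fib d)))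
            (fun c : ↥(pbox (fine Lc M)) × Fin (d + 1) => ((c.1, Sum.inl c.2) : Idx (fine Lc M) (Fib d))) := fun v v' => by
    subst hW; rfl
  rw [hS, hS, Finset.sum_comm]
  refine Finset.sum_congr rfl fun b' _ => Finset.sum_congr rfl fun b _ => ?_
  rw [mul_comm, submatrix_perF_dper_borderT2_swap (M := fine Lc M) (M' := M) hr (fun _ => rfl) hW
    (fun a : ↥(pbox M) × Fin (d + 1) => (coarsePt M Lc a.1 : Site (d + 1))) (fun a => (coarsePt M Lc a.1).2) (fun a => a.2) b' b]

end OneStep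

/-! ## §2 The composite bilinear companion, at every depth -/

section Tower

variable (Lc : ℕ) [NeZero Lc]

/-- [our object — bookkeeping] **THE COMPOSITE SECOND-ORDER INSERTION BI-JET OF THE `n`-FOLD AVERAGING ALONG TWO BOND WEIGHTS `h, h′` — I-4's ♭ second chain rule,
POLARISED** (push-inside recursion): `0` at depth `0`; at depth `n+1`: `(θ_n∕σ_n)•stepIns₂₂(C h, C h′)·C + θ_n•(stepIns₁(C h)·compIns₁ h′ + stepIns₁(C h′)·compIns₁ h) +
Qstep·compIns₂₂^{low} h h′` (the cross summand of I-4's `2θ_n•stepIns₁(C h)·compIns₁ h` split symmetrically).  Same scalars as I-4. -/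
def compIns₂₂ : (M : Fin (d + 1) → ℕ) → [∀ μ, NeZero (M μ)] → (lev : ℕ → ℕ) → (rs : ℕ → (Fin (d + 1) → ℕ)) → (n : ℕ) →
    ((↥(pbox (towerTorus Lc M n)) × Fin (d + 1) → ℝ)) → ((↥(pbox (towerTorus Lc M n)) × Fin (d + 1) → ℝ)) →
      Matrix (↥(pbox M) × Fin (d + 1)) (↥(pbox (towerTorus Lc M n)) × Fin (d + 1)) ℝ
  | _, _, _, _, 0, _, _ => 0
  | M, _, lev, rs, n + 1, h, h' =>
    ((((Lc : ℝ) ^ (d + 1) * stepScale d Lc (lev 1)) * (∏ i ∈ range n, (stepScale d Lc (lev (i + 1 + 1)) * ((box (d + 1) Lc).card : ℝ)))⁻¹) * (∏ i ∈ range n, (stepScale d Lc (lev (i + 1 + 1)) * ((box (d + 1) Lc).card : ℝ)))⁻¹) •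
            (stepIns₂₂ M Lc (rs 1) (compRows Lc (fine Lc M) (fun k => lev (k + 1)) (fun k => rs (k + 1)) n *ᵥ h) (compRows Lc (fine Lc M) (fun k => lev (k + 1)) (fun k => rs (k + 1)) n *ᵥ h') * compRows Lc (fine Lc M) (fun k => lev (k + 1)) (fun k => rs (k + 1)) n)
        + (((Lc : ℝ) ^ (d + 1) * stepScale d Lc (lev 1)) * (∏ i ∈ range n, (stepScale d Lc (lev (i + 1 + 1)) * ((box (d + 1) Lc).card : ℝ)))⁻¹) • (stepIns₁ M Lc (rs 1) (compRows Lc (fine Lc M) (fun k => lev (k + 1)) (fun k => rs (k + 1)) n *ᵥ h) * compIns₁ Lc (fine Lc M) (fun k => lev (k + 1)) (fun k => rs (k + 1)) n h' + stepIns₁ M Lc (rs 1) (compRows Lc (fine Lc M) (fun k => lev (k + 1)) (fun k => rs (k + 1)) n *ᵥ h') * compIns₁ Lc (fine Lc M) (fun k => lev (k + 1)) (fun k => rs (k + 1)) n h)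
        + Qstep Lc M (lev 1) (rs 1) * compIns₂₂ (fine Lc M) (fun k => lev (k + 1)) (fun k => rs (k + 1)) n h h'

/-- unfolding, depth `0`. -/
@[simp] theorem compIns₂₂_zero (M : Fin (d + 1) → ℕ) [∀ μ, NeZero (M μ)] (lev : ℕ → ℕ) (rs : ℕ → (Fin (d + 1) → ℕ)) (h h' : ↥(pbox M) × Fin (d + 1) → ℝ) :
    compIns₂₂ Lc M lev rs 0 h h' = 0 := rfl

/-- unfolding, depth `n+1` (`rfl`). -/
theorem compIns₂₂_succ (M : Fin (d + 1) → ℕ) [∀ μ, NeZero (M μ)] (lev : ℕ → ℕ) (rs : ℕ → (Fin (d + 1) → ℕ)) (n : ℕ) (h h' : ↥(pbox (towerTorus Lc (fine Lc M) n)) × Fin (d + 1) → ℝ) :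
    compIns₂₂ Lc M lev rs (n + 1) h h'
      = ((((Lc : ℝ) ^ (d + 1) * stepScale d Lc (lev 1)) * (∏ i ∈ range n, (stepScale d Lc (lev (i + 1 + 1)) * ((box (d + 1) Lc).card : ℝ)))⁻¹) * (∏ i ∈ range n, (stepScale d Lc (lev (i + 1 + 1)) * ((box (d + 1) Lc).card : ℝ)))⁻¹) •
            (stepIns₂₂ M Lc (rs 1) (compRows Lc (fine Lc M) (fun k => lev (k + 1)) (fun k => rs (k + 1)) n *ᵥ h) (compRows Lc (fine Lc M) (fun k => lev (k + 1)) (fun k => rs (k + 1)) n *ᵥ h') * compRows Lc (fine Lc M) (fun k => lev (k + 1)) (fun k => rs (k + 1)) n)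
        + (((Lc : ℝ) ^ (d + 1) * stepScale d Lc (lev 1)) * (∏ i ∈ range n, (stepScale d Lc (lev (i + 1 + 1)) * ((box (d + 1) Lc).card : ℝ)))⁻¹) • (stepIns₁ M Lc (rs 1) (compRows Lc (fine Lc M) (fun k => lev (k + 1)) (fun k => rs (k + 1)) n *ᵥ h) * compIns₁ Lc (fine Lc M) (fun k => lev (k + 1)) (fun k => rs (k + 1)) n h' + stepIns₁ M Lc (rs 1) (compRows Lc (fine Lc M) (fun k => lev (k + 1)) (fun k => rs (k + 1)) n *ᵥ h') * compIns₁ Lc (fine Lc M) (fun k => lev (k + 1)) (fun k => rs (k + 1)) n h)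
        + Qstep Lc M (lev 1) (rs 1) * compIns₂₂ Lc (fine Lc M) (fun k => lev (k + 1)) (fun k => rs (k + 1)) n h h' := rfl

/-- [folklore] the diagonal, THE INDUCTION STEP (push-inside types): `2θ•(T₁·I₁) = θ•(T₁·I₁ + T₁·I₁)`. -/
theorem compIns₂₂_self_step (n : ℕ) (M : Fin (d + 1) → ℕ) [∀ μ, NeZero (M μ)] (lev : ℕ → ℕ) (rs : ℕ → (Fin (d + 1) → ℕ)) (h : ↥(pbox (towerTorus Lc (fine Lc M) n)) × Fin (d + 1) → ℝ)
    (ih : compIns₂₂ Lc (fine Lc M) (fun k => lev (k + 1)) (fun k => rs (k + 1)) n h h = compIns₂ Lc (fine Lc M) (fun k => lev (k + 1)) (fun k => rs (k + 1)) n h) :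
    ((((Lc : ℝ) ^ (d + 1) * stepScale d Lc (lev 1)) * (∏ i ∈ range n, (stepScale d Lc (lev (i + 1 + 1)) * ((box (d + 1) Lc).card : ℝ)))⁻¹) * (∏ i ∈ range n, (stepScale d Lc (lev (i + 1 + 1)) * ((box (d + 1) Lc).card : ℝ)))⁻¹) •
            (stepIns₂₂ M Lc (rs 1) (compRows Lc (fine Lc M) (fun k => lev (k + 1)) (fun k => rs (k + 1)) n *ᵥ h) (compRows Lc (fine Lc M) (fun k => lev (k + 1)) (fun k => rs (k + 1)) n *ᵥ h) * compRows Lc (fine Lc M) (fun k => lev (k + 1)) (fun k => rs (k + 1)) n)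
        + (((Lc : ℝ) ^ (d + 1) * stepScale d Lc (lev 1)) * (∏ i ∈ range n, (stepScale d Lc (lev (i + 1 + 1)) * ((box (d + 1) Lc).card : ℝ)))⁻¹) • (stepIns₁ M Lc (rs 1) (compRows Lc (fine Lc M) (fun k => lev (k + 1)) (fun k => rs (k + 1)) n *ᵥ h) * compIns₁ Lc (fine Lc M) (fun k => lev (k + 1)) (fun k => rs (k + 1)) n h + stepIns₁ M Lc (rs 1) (compRows Lc (fine Lc M) (fun k => lev (k + 1)) (fun k => rs (k + 1)) n *ᵥ h) * compIns₁ Lc (fine Lc M) (fun k => lev (k + 1)) (fun k => rs (k + 1)) n h)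
        + Qstep Lc M (lev 1) (rs 1) * compIns₂₂ Lc (fine Lc M) (fun k => lev (k + 1)) (fun k => rs (k + 1)) n h h
      = ((((Lc : ℝ) ^ (d + 1) * stepScale d Lc (lev 1)) * (∏ i ∈ range n, (stepScale d Lc (lev (i + 1 + 1)) * ((box (d + 1) Lc).card : ℝ)))⁻¹) * (∏ i ∈ range n, (stepScale d Lc (lev (i + 1 + 1)) * ((box (d + 1) Lc).card : ℝ)))⁻¹) •
            (stepIns₂ M Lc (rs 1) (compRows Lc (fine Lc M) (fun k => lev (k + 1)) (fun k => rs (k + 1)) n *ᵥ h) * compRows Lc (fine Lc M) (fun k => lev (k + 1)) (fun k => rs (k + 1)) n)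
        + ((2 : ℝ) * (((Lc : ℝ) ^ (d + 1) * stepScale d Lc (lev 1)) * (∏ i ∈ range n, (stepScale d Lc (lev (i + 1 + 1)) * ((box (d + 1) Lc).card : ℝ)))⁻¹)) • (stepIns₁ M Lc (rs 1) (compRows Lc (fine Lc M) (fun k => lev (k + 1)) (fun k => rs (k + 1)) n *ᵥ h) * compIns₁ Lc (fine Lc M) (fun k => lev (k + 1)) (fun k => rs (k + 1)) n h)
        + Qstep Lc M (lev 1) (rs 1) * compIns₂ Lc (fine Lc M) (fun k => lev (k + 1)) (fun k => rs (k + 1)) n h := by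
  rw [stepIns₂₂_self, ih, two_mul, add_smul, smul_add]

/-- [folklore] **the diagonal of the bi-jet IS I-4's composite second jet**: `compIns₂₂ … n h h = compIns₂ … n h`. -/
theorem compIns₂₂_self :
    ∀ (n : ℕ) (M : Fin (d + 1) → ℕ) [∀ μ, NeZero (M μ)] (lev : ℕ → ℕ) (rs : ℕ → (Fin (d + 1) → ℕ)) (h : ↥(pbox (towerTorus Lc M n)) × Fin (d + 1) → ℝ),
      compIns₂₂ Lc M lev rs n h h = compIns₂ Lc M lev rs n h
  | 0, M, _, lev, rs, h => by simp only [compIns₂₂_zero, compIns₂_zero]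
  | n + 1, M, _, lev, rs, h => compIns₂₂_self_step Lc n M lev rs h (compIns₂₂_self n (fine Lc M) (fun k => lev (k + 1)) (fun k => rs (k + 1)) h)

/-- [folklore] symmetry, THE INDUCTION STEP (`rs 1 ∈ box` for §1's `stepIns₂₂_comm`). -/
theorem compIns₂₂_comm_step (n : ℕ) (M : Fin (d + 1) → ℕ) [∀ μ, NeZero (M μ)] (lev : ℕ → ℕ) (rs : ℕ → (Fin (d + 1) → ℕ)) (hrs : ∀ k, rs k ∈ box (d + 1) Lc)
    (h h' : ↥(pbox (towerTorus Lc (fine Lc M) n)) × Fin (d + 1) → ℝ) (ih : compIns₂₂ Lc (fine Lc M) (fun k => lev (k + 1)) (fun k => rs (k + 1)) n h h' = compIns₂₂ Lc (fine Lc M) (fun k => lev (k + 1)) (fun k => rs (k + 1)) n h' h) :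
    ((((Lc : ℝ) ^ (d + 1) * stepScale d Lc (lev 1)) * (∏ i ∈ range n, (stepScale d Lc (lev (i + 1 + 1)) * ((box (d + 1) Lc).card : ℝ)))⁻¹) * (∏ i ∈ range n, (stepScale d Lc (lev (i + 1 + 1)) * ((box (d + 1) Lc).card : ℝ)))⁻¹) •
            (stepIns₂₂ M Lc (rs 1) (compRows Lc (fine Lc M) (fun k => lev (k + 1)) (fun k => rs (k + 1)) n *ᵥ h) (compRows Lc (fine Lc M) (fun k => lev (k + 1)) (fun k => rs (k + 1)) n *ᵥ h') * compRows Lc (fine Lc M) (fun k => lev (k + 1)) (fun k => rs (k + 1)) n)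
        + (((Lc : ℝ) ^ (d + 1) * stepScale d Lc (lev 1)) * (∏ i ∈ range n, (stepScale d Lc (lev (i + 1 + 1)) * ((box (d + 1) Lc).card : ℝ)))⁻¹) • (stepIns₁ M Lc (rs 1) (compRows Lc (fine Lc M) (fun k => lev (k + 1)) (fun k => rs (k + 1)) n *ᵥ h) * compIns₁ Lc (fine Lc M) (fun k => lev (k + 1)) (fun k => rs (k + 1)) n h' + stepIns₁ M Lc (rs 1) (compRows Lc (fine Lc M) (fun k => lev (k + 1)) (fun k => rs (k + 1)) n *ᵥ h') * compIns₁ Lc (fine Lc M) (fun k => lev (k + 1)) (fun k => rs (k + 1)) n h)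
        + Qstep Lc M (lev 1) (rs 1) * compIns₂₂ Lc (fine Lc M) (fun k => lev (k + 1)) (fun k => rs (k + 1)) n h h'
      = ((((Lc : ℝ) ^ (d + 1) * stepScale d Lc (lev 1)) * (∏ i ∈ range n, (stepScale d Lc (lev (i + 1 + 1)) * ((box (d + 1) Lc).card : ℝ)))⁻¹) * (∏ i ∈ range n, (stepScale d Lc (lev (i + 1 + 1)) * ((box (d + 1) Lc).card : ℝ)))⁻¹) •
            (stepIns₂₂ M Lc (rs 1) (compRows Lc (fine Lc M) (fun k => lev (k + 1)) (fun k => rs (k + 1)) n *ᵥ h') (compRows Lc (fine Lc M) (fun k => lev (k + 1)) (fun k => rs (k + 1)) n *ᵥ h) * compRows Lc (fine Lc M) (fun k => lev (k + 1)) (fun k => rs (k + 1)) n)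
        + (((Lc : ℝ) ^ (d + 1) * stepScale d Lc (lev 1)) * (∏ i ∈ range n, (stepScale d Lc (lev (i + 1 + 1)) * ((box (d + 1) Lc).card : ℝ)))⁻¹) • (stepIns₁ M Lc (rs 1) (compRows Lc (fine Lc M) (fun k => lev (k + 1)) (fun k => rs (k + 1)) n *ᵥ h') * compIns₁ Lc (fine Lc M) (fun k => lev (k + 1)) (fun k => rs (k + 1)) n h + stepIns₁ M Lc (rs 1) (compRows Lc (fine Lc M) (fun k => lev (k + 1)) (fun k => rs (k + 1)) n *ᵥ h) * compIns₁ Lc (fine Lc M) (fun k => lev (k + 1)) (fun k => rs (k + 1)) n h')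
        + Qstep Lc M (lev 1) (rs 1) * compIns₂₂ Lc (fine Lc M) (fun k => lev (k + 1)) (fun k => rs (k + 1)) n h' h := by
  rw [stepIns₂₂_comm M Lc (hrs 1), ih, add_comm (stepIns₁ M Lc (rs 1) (compRows Lc (fine Lc M) (fun k => lev (k + 1)) (fun k => rs (k + 1)) n *ᵥ h) * compIns₁ Lc (fine Lc M) (fun k => lev (k + 1)) (fun k => rs (k + 1)) n h')]

/-- [folklore] **SYMMETRIC**: `compIns₂₂ … n h h′ = compIns₂₂ … n h′ h`. -/
theorem compIns₂₂_comm :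
    ∀ (n : ℕ) (M : Fin (d + 1) → ℕ) [∀ μ, NeZero (M μ)] (lev : ℕ → ℕ) (rs : ℕ → (Fin (d + 1) → ℕ)) (hrs : ∀ k, rs k ∈ box (d + 1) Lc)
      (h h' : ↥(pbox (towerTorus Lc M n)) × Fin (d + 1) → ℝ),
      compIns₂₂ Lc M lev rs n h h' = compIns₂₂ Lc M lev rs n h' h
  | 0, M, _, lev, rs, hrs, h, h' => by simp only [compIns₂₂_zero]
  | n + 1, M, _, lev, rs, hrs, h, h' =>
    compIns₂₂_comm_step Lc n M lev rs hrs h h' (compIns₂₂_comm n (fine Lc M) (fun k => lev (k + 1)) (fun k => rs (k + 1)) (fun k => hrs (k + 1)) h h')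

/-- [folklore] additivity in the first weight, THE INDUCTION STEP (`stepIns₂₂_add_left`, `stepIns₁_add`, `compIns₁_add`, `ih`). -/
theorem compIns₂₂_add_left_step (n : ℕ) (M : Fin (d + 1) → ℕ) [∀ μ, NeZero (M μ)] (lev : ℕ → ℕ) (rs : ℕ → (Fin (d + 1) → ℕ))
    (h₁ h₂ h' : ↥(pbox (towerTorus Lc (fine Lc M) n)) × Fin (d + 1) → ℝ)
    (ih : compIns₂₂ Lc (fine Lc M) (fun k => lev (k + 1)) (fun k => rs (k + 1)) n (h₁ + h₂) h' = compIns₂₂ Lc (fine Lc M) (fun k => lev (k + 1)) (fun k => rs (k + 1)) n h₁ h' + compIns₂₂ Lc (fine Lc M) (fun k => lev (k + 1)) (fun k => rs (k + 1)) n h₂ h') :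
    ((((Lc : ℝ) ^ (d + 1) * stepScale d Lc (lev 1)) * (∏ i ∈ range n, (stepScale d Lc (lev (i + 1 + 1)) * ((box (d + 1) Lc).card : ℝ)))⁻¹) * (∏ i ∈ range n, (stepScale d Lc (lev (i + 1 + 1)) * ((box (d + 1) Lc).card : ℝ)))⁻¹) •
            (stepIns₂₂ M Lc (rs 1) (compRows Lc (fine Lc M) (fun k => lev (k + 1)) (fun k => rs (k + 1)) n *ᵥ (h₁ + h₂)) (compRows Lc (fine Lc M) (fun k => lev (k + 1)) (fun k => rs (k + 1)) n *ᵥ h') * compRows Lc (fine Lc M) (fun k => lev (k + 1)) (fun k => rs (k + 1)) n)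
        + (((Lc : ℝ) ^ (d + 1) * stepScale d Lc (lev 1)) * (∏ i ∈ range n, (stepScale d Lc (lev (i + 1 + 1)) * ((box (d + 1) Lc).card : ℝ)))⁻¹) • (stepIns₁ M Lc (rs 1) (compRows Lc (fine Lc M) (fun k => lev (k + 1)) (fun k => rs (k + 1)) n *ᵥ (h₁ + h₂)) * compIns₁ Lc (fine Lc M) (fun k => lev (k + 1)) (fun k => rs (k + 1)) n h' + stepIns₁ M Lc (rs 1) (compRows Lc (fine Lc M) (fun k => lev (k + 1)) (fun k => rs (k + 1)) n *ᵥ h') * compIns₁ Lc (fine Lc M) (fun k => lev (k + 1)) (fun k => rs (k + 1)) n (h₁ + h₂))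
        + Qstep Lc M (lev 1) (rs 1) * compIns₂₂ Lc (fine Lc M) (fun k => lev (k + 1)) (fun k => rs (k + 1)) n (h₁ + h₂) h'
      = (((((Lc : ℝ) ^ (d + 1) * stepScale d Lc (lev 1)) * (∏ i ∈ range n, (stepScale d Lc (lev (i + 1 + 1)) * ((box (d + 1) Lc).card : ℝ)))⁻¹) * (∏ i ∈ range n, (stepScale d Lc (lev (i + 1 + 1)) * ((box (d + 1) Lc).card : ℝ)))⁻¹) •
            (stepIns₂₂ M Lc (rs 1) (compRows Lc (fine Lc M) (fun k => lev (k + 1)) (fun k => rs (k + 1)) n *ᵥ h₁) (compRows Lc (fine Lc M) (fun k => lev (k + 1)) (fun k => rs (k + 1)) n *ᵥ h') * compRows Lc (fine Lc M) (fun k => lev (k + 1)) (fun k => rs (k + 1)) n)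
        + (((Lc : ℝ) ^ (d + 1) * stepScale d Lc (lev 1)) * (∏ i ∈ range n, (stepScale d Lc (lev (i + 1 + 1)) * ((box (d + 1) Lc).card : ℝ)))⁻¹) • (stepIns₁ M Lc (rs 1) (compRows Lc (fine Lc M) (fun k => lev (k + 1)) (fun k => rs (k + 1)) n *ᵥ h₁) * compIns₁ Lc (fine Lc M) (fun k => lev (k + 1)) (fun k => rs (k + 1)) n h' + stepIns₁ M Lc (rs 1) (compRows Lc (fine Lc M) (fun k => lev (k + 1)) (fun k => rs (k + 1)) n *ᵥ h') * compIns₁ Lc (fine Lc M) (fun k => lev (k + 1)) (fun k => rs (k + 1)) n h₁)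
        + Qstep Lc M (lev 1) (rs 1) * compIns₂₂ Lc (fine Lc M) (fun k => lev (k + 1)) (fun k => rs (k + 1)) n h₁ h')
        + (((((Lc : ℝ) ^ (d + 1) * stepScale d Lc (lev 1)) * (∏ i ∈ range n, (stepScale d Lc (lev (i + 1 + 1)) * ((box (d + 1) Lc).card : ℝ)))⁻¹) * (∏ i ∈ range n, (stepScale d Lc (lev (i + 1 + 1)) * ((box (d + 1) Lc).card : ℝ)))⁻¹) •
            (stepIns₂₂ M Lc (rs 1) (compRows Lc (fine Lc M) (fun k => lev (k + 1)) (fun k => rs (k + 1)) n *ᵥ h₂) (compRows Lc (fine Lc M) (fun k => lev (k + 1)) (fun k => rs (k + 1)) n *ᵥ h') * compRows Lc (fine Lc M) (fun k => lev (k + 1)) (fun k => rs (k + 1)) n)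
        + (((Lc : ℝ) ^ (d + 1) * stepScale d Lc (lev 1)) * (∏ i ∈ range n, (stepScale d Lc (lev (i + 1 + 1)) * ((box (d + 1) Lc).card : ℝ)))⁻¹) • (stepIns₁ M Lc (rs 1) (compRows Lc (fine Lc M) (fun k => lev (k + 1)) (fun k => rs (k + 1)) n *ᵥ h₂) * compIns₁ Lc (fine Lc M) (fun k => lev (k + 1)) (fun k => rs (k + 1)) n h' + stepIns₁ M Lc (rs 1) (compRows Lc (fine Lc M) (fun k => lev (k + 1)) (fun k => rs (k + 1)) n *ᵥ h') * compIns₁ Lc (fine Lc M) (fun k => lev (k + 1)) (fun k => rs (k + 1)) n h₂)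
        + Qstep Lc M (lev 1) (rs 1) * compIns₂₂ Lc (fine Lc M) (fun k => lev (k + 1)) (fun k => rs (k + 1)) n h₂ h') := by
  rw [ih, Matrix.mulVec_add, stepIns₂₂_add_left, stepIns₁_add, compIns₁_add]
  simp only [Matrix.add_mul, Matrix.mul_add, smul_add]
  abel

/-- [folklore] **ADDITIVE IN THE FIRST WEIGHT**. -/
theorem compIns₂₂_add_left :
    ∀ (n : ℕ) (M : Fin (d + 1) → ℕ) [∀ μ, NeZero (M μ)] (lev : ℕ → ℕ) (rs : ℕ → (Fin (d + 1) → ℕ))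
      (h₁ h₂ h' : ↥(pbox (towerTorus Lc M n)) × Fin (d + 1) → ℝ),
      compIns₂₂ Lc M lev rs n (h₁ + h₂) h' = compIns₂₂ Lc M lev rs n h₁ h' + compIns₂₂ Lc M lev rs n h₂ h'
  | 0, M, _, lev, rs, h₁, h₂, h' => by simp only [compIns₂₂_zero, add_zero]
  | n + 1, M, _, lev, rs, h₁, h₂, h' =>
    compIns₂₂_add_left_step Lc n M lev rs h₁ h₂ h' (compIns₂₂_add_left n (fine Lc M) (fun k => lev (k + 1)) (fun k => rs (k + 1)) h₁ h₂ h')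

/-- [folklore] homogeneity in the first weight, THE INDUCTION STEP. -/
theorem compIns₂₂_smul_left_step (n : ℕ) (M : Fin (d + 1) → ℕ) [∀ μ, NeZero (M μ)] (lev : ℕ → ℕ) (rs : ℕ → (Fin (d + 1) → ℕ)) (t : ℝ)
    (h h' : ↥(pbox (towerTorus Lc (fine Lc M) n)) × Fin (d + 1) → ℝ) (ih : compIns₂₂ Lc (fine Lc M) (fun k => lev (k + 1)) (fun k => rs (k + 1)) n (t • h) h' = t • compIns₂₂ Lc (fine Lc M) (fun k => lev (k + 1)) (fun k => rs (k + 1)) n h h') :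
    ((((Lc : ℝ) ^ (d + 1) * stepScale d Lc (lev 1)) * (∏ i ∈ range n, (stepScale d Lc (lev (i + 1 + 1)) * ((box (d + 1) Lc).card : ℝ)))⁻¹) * (∏ i ∈ range n, (stepScale d Lc (lev (i + 1 + 1)) * ((box (d + 1) Lc).card : ℝ)))⁻¹) •
            (stepIns₂₂ M Lc (rs 1) (compRows Lc (fine Lc M) (fun k => lev (k + 1)) (fun k => rs (k + 1)) n *ᵥ (t • h)) (compRows Lc (fine Lc M) (fun k => lev (k + 1)) (fun k => rs (k + 1)) n *ᵥ h') * compRows Lc (fine Lc M) (fun k => lev (k + 1)) (fun k => rs (k + 1)) n)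
        + (((Lc : ℝ) ^ (d + 1) * stepScale d Lc (lev 1)) * (∏ i ∈ range n, (stepScale d Lc (lev (i + 1 + 1)) * ((box (d + 1) Lc).card : ℝ)))⁻¹) • (stepIns₁ M Lc (rs 1) (compRows Lc (fine Lc M) (fun k => lev (k + 1)) (fun k => rs (k + 1)) n *ᵥ (t • h)) * compIns₁ Lc (fine Lc M) (fun k => lev (k + 1)) (fun k => rs (k + 1)) n h' + stepIns₁ M Lc (rs 1) (compRows Lc (fine Lc M) (fun k => lev (k + 1)) (fun k => rs (k + 1)) n *ᵥ h') * compIns₁ Lc (fine Lc M) (fun k => lev (k + 1)) (fun k => rs (k + 1)) n (t • h))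
        + Qstep Lc M (lev 1) (rs 1) * compIns₂₂ Lc (fine Lc M) (fun k => lev (k + 1)) (fun k => rs (k + 1)) n (t • h) h'
      = t • (((((Lc : ℝ) ^ (d + 1) * stepScale d Lc (lev 1)) * (∏ i ∈ range n, (stepScale d Lc (lev (i + 1 + 1)) * ((box (d + 1) Lc).card : ℝ)))⁻¹) * (∏ i ∈ range n, (stepScale d Lc (lev (i + 1 + 1)) * ((box (d + 1) Lc).card : ℝ)))⁻¹) •
            (stepIns₂₂ M Lc (rs 1) (compRows Lc (fine Lc M) (fun k => lev (k + 1)) (fun k => rs (k + 1)) n *ᵥ h) (compRows Lc (fine Lc M) (fun k => lev (k + 1)) (fun k => rs (k + 1)) n *ᵥ h') * compRows Lc (fine Lc M) (fun k => lev (k + 1)) (fun k => rs (k + 1)) n)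
        + (((Lc : ℝ) ^ (d + 1) * stepScale d Lc (lev 1)) * (∏ i ∈ range n, (stepScale d Lc (lev (i + 1 + 1)) * ((box (d + 1) Lc).card : ℝ)))⁻¹) • (stepIns₁ M Lc (rs 1) (compRows Lc (fine Lc M) (fun k => lev (k + 1)) (fun k => rs (k + 1)) n *ᵥ h) * compIns₁ Lc (fine Lc M) (fun k => lev (k + 1)) (fun k => rs (k + 1)) n h' + stepIns₁ M Lc (rs 1) (compRows Lc (fine Lc M) (fun k => lev (k + 1)) (fun k => rs (k + 1)) n *ᵥ h') * compIns₁ Lc (fine Lc M) (fun k => lev (k + 1)) (fun k => rs (k + 1)) n h)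
        + Qstep Lc M (lev 1) (rs 1) * compIns₂₂ Lc (fine Lc M) (fun k => lev (k + 1)) (fun k => rs (k + 1)) n h h') := by
  rw [ih, Matrix.mulVec_smul, stepIns₂₂_smul_left, stepIns₁_smul, compIns₁_smul]
  simp only [Matrix.smul_mul, Matrix.mul_smul, smul_add, smul_smul, mul_comm t]

/-- [folklore] **HOMOGENEOUS IN THE FIRST WEIGHT**. -/
theorem compIns₂₂_smul_left :
    ∀ (n : ℕ) (M : Fin (d + 1) → ℕ) [∀ μ, NeZero (M μ)] (lev : ℕ → ℕ) (rs : ℕ → (Fin (d + 1) → ℕ)) (t : ℝ)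
      (h h' : ↥(pbox (towerTorus Lc M n)) × Fin (d + 1) → ℝ),
      compIns₂₂ Lc M lev rs n (t • h) h' = t • compIns₂₂ Lc M lev rs n h h'
  | 0, M, _, lev, rs, t, h, h' => by simp only [compIns₂₂_zero, smul_zero]
  | n + 1, M, _, lev, rs, t, h, h' =>
    compIns₂₂_smul_left_step Lc n M lev rs t h h' (compIns₂₂_smul_left n (fine Lc M) (fun k => lev (k + 1)) (fun k => rs (k + 1)) t h h')

/-- [folklore] additive in the second weight (by symmetry). -/
theorem compIns₂₂_add_right (n : ℕ) (M : Fin (d + 1) → ℕ) [∀ μ, NeZero (M μ)] (lev : ℕ → ℕ) (rs : ℕ → (Fin (d + 1) → ℕ)) (hrs : ∀ k, rs k ∈ box (d + 1) Lc)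
    (h h₁ h₂ : ↥(pbox (towerTorus Lc M n)) × Fin (d + 1) → ℝ) :
    compIns₂₂ Lc M lev rs n h (h₁ + h₂) = compIns₂₂ Lc M lev rs n h h₁ + compIns₂₂ Lc M lev rs n h h₂ := by
  rw [compIns₂₂_comm Lc n M lev rs hrs, compIns₂₂_add_left, compIns₂₂_comm Lc n M lev rs hrs h₁, compIns₂₂_comm Lc n M lev rs hrs h₂]

/-- [folklore] homogeneous in the second weight (by symmetry). -/
theorem compIns₂₂_smul_right (n : ℕ) (M : Fin (d + 1) → ℕ) [∀ μ, NeZero (M μ)] (lev : ℕ → ℕ) (rs : ℕ → (Fin (d + 1) → ℕ)) (hrs : ∀ k, rs k ∈ box (d + 1) Lc) (t : ℝ)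
    (h h' : ↥(pbox (towerTorus Lc M n)) × Fin (d + 1) → ℝ) :
    compIns₂₂ Lc M lev rs n h (t • h') = t • compIns₂₂ Lc M lev rs n h h' := by
  rw [compIns₂₂_comm Lc n M lev rs hrs, compIns₂₂_smul_left, compIns₂₂_comm Lc n M lev rs hrs h']

/-- [folklore] **`compIns₂_add` — THE POLARISATION IDENTITY OF OUR COMPOSITE SECOND JET**: `compIns₂ … n (h + h′) = compIns₂ … n h + (compIns₂₂ … n h h′ + compIns₂₂ … n h h′)
+ compIns₂ … n h′` — the MIXED companion a point-source polarisation of the composite door needs ((28d)). -/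
theorem compIns₂_add (n : ℕ) (M : Fin (d + 1) → ℕ) [∀ μ, NeZero (M μ)] (lev : ℕ → ℕ) (rs : ℕ → (Fin (d + 1) → ℕ)) (hrs : ∀ k, rs k ∈ box (d + 1) Lc)
    (h h' : ↥(pbox (towerTorus Lc M n)) × Fin (d + 1) → ℝ) :
    compIns₂ Lc M lev rs n (h + h') = compIns₂ Lc M lev rs n h + (compIns₂₂ Lc M lev rs n h h' + compIns₂₂ Lc M lev rs n h h') + compIns₂ Lc M lev rs n h' := by
  rw [← compIns₂₂_self, ← compIns₂₂_self, ← compIns₂₂_self, compIns₂₂_add_left, compIns₂₂_add_right Lc n M lev rs hrs, compIns₂₂_add_right Lc n M lev rs hrs,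
    compIns₂₂_comm Lc n M lev rs hrs h' h]
  abel

end Tower

end Summit.QuantumFields.BalabanUV.Beta.FP.TorusCompositeCovarianceTwoPolar

end
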